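import Summits.QuantumFields.BalabanUV.T4Continuum.Support.NE7ApeCurvedRepPointedGauge
import Summits.QuantumFields.BalabanUV.T4Continuum.Support.NE3QuadRemainderFibre
import Summits.QuantumFields.BalabanUV.T4Continuum.Support.NE3RightInverseLetters
import Summits.QuantumFields.BalabanUV.T4Continuum.Support.NE7TangentTransportGauge
import Summits.QuantumFields.BalabanUV.T4Continuum.Support.NE7ExpansionSegmentLetters
import Summits.QuantumFields.BalabanUV.T4Continuum.Support.NE3HessContinuity
import Summits.QuantumFields.BalabanUV.T4Continuum.Support.NE3HessBounds
import HarnessLib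

/-!
# NE7SameTopNormalLift — (L1)′ FOR SAME-TOP FIELDS IS SECOND ORDER AND KINEMATIC: if `cavgIter (j+1) (We^{Z}) = cavgIter (j+1) W` then the datum
# `A = dirIter (j+1) W Z` is the NEGATIVE QUADRATIC REMAINDER (`‖A‖ ≤ 4(3+12d)³∕ρ₀²·(Mα₀)²`, tree `NE3QuadRemainderFibre`), and row NE3's exact curved right
# inverse `R_W A` is a normal lift with sup `m = supC∕(M(1−θ))·‖A‖`, curl `≤ 4m`, and `|hess_W(R_W A, Y)| ≤ 24·#Plane·m·‖Y‖_{ℓ¹}` — the three analytic conjuncts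
# of F108's letter `hNlift` DISCHARGED for every same-top field, with constants of order `(Mα₀)²`; file 42

Cell `pub-balaban`, rung (B)+1 sub-cell t4, lineage `b2b-balaban-t4-ne7-p1` (CRUX PROVER NE7 #1 = OWNER of row NE7), generation 78; memo
`t4/b2b-balaban-t4-ne7-p1-g78/BUMP-CLASS-FLAT.md` §7 (ii).  File F111 (over `NE3QuadRemainderFibre.norm_dirIter_le_of_fibre` ([Balaban1985Averaging] Prop. 4
(134)–(135): at a fibre point the linearised average is minus the quadratic remainder), `NE3RightInverseLetters` (`rightInvW`: exact, skew, periodic, (R5) sup letter),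
`NE7TangentTransportGauge.dirIter_skew_periodic`, `NE3HessContinuity.abs_hessPlaqAt_le`, `NE3HessBounds.norm_curlAt_le`, `NE7ExpansionSegmentLetters.sum_perWin_bondL1At_le`).
WHY.  After F108∕F110 (road (B) docked and assembled) the curved (APE) with a datum asks the normal-lift letter (L1)′ only for SAME-TOP fields `Z′`
(`cavgIter(We^{Z′}) = cavgIter W` exactly — the pointed gauge).  For such fields the top-level datum to be lifted is not `O(α₀)` but `O((Mα₀)²)`: the
consistency identity `cavgIter(We^{Z′}) = cavgIter(W)·e^{relIter Z′}` forces `relIter Z′ = 0`, so `dirIter Z′ = −(relIter − dirIter)(Z′)`, the quadratic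
remainder.  Hence NO `1∕M²`-priced solver is needed at (L1)′: the crude sup letter (R5) of row NE3's right inverse and the crude Hessian continuity
`|hess_p(X,Y)| ≤ 3·bl₁(X)(p)·bl₁(Y)(p)` already give second-order constants.  THIS FILE is that composition (g75's remark (R7′) made a kernel theorem by the
same-top premise of road (B)).  What remains ANALYTIC on road (B) after it: the `∈ S` clause of `hNlift` (bookkeeping: `Z′ − R_W A` is `W`-tangent, skew,
periodic), α₁ (the gradient member of E′'s Landau `Z`), and (L2) (the slice solver).
WHAT ([folklore]; 0 def, 0 sorry).  **`exists_normalLift_sameTop`**: for `W` in the class (`LevelSmall j` and `LevelSmall (j+1)`, `curvSum (j+1) x ≤ 2L∕3`, the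
right-inverse regime `cruxC·M²x < 1`, `M²x ≤ 1`) and a same-top skew periodic `Z` of radius `α₀` with `4(3+12d)²·M·α₀ ≤ ρ₀²`: `∃ AN` skew, `NM`-periodic,
`dirIter (j+1) W AN = dirIter (j+1) W Z`, `‖AN‖ ≤ m`, `‖curlAt W AN z μ′ ν′‖ ≤ 4m`, `|hess W AN Y (perWin)| ≤ 24·#Plane·m·dirL1 Y (periodBox)` for every
`NM`-periodic `Y`, with `m = supC∕(M(1 − cruxC·M²x)) · (4(3+12d)³∕ρ₀²)·(Mα₀)²`.
HONEST FRAMING (page 1): composition of landed row-NE3 kinematics; nothing of Bałaban's asserted; α₁ and (L2) untouched; (APE) on curved data NOT proved; NOT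
ONE-STEP, NOT NE7; spine 0∕9; finite T⁴ rung (B)+1 — NOT infinite volume, NOT mass gap, NOT `BetaPertH`, NOT Clay.  Continuum YM on T⁴ ⇐ BetaPertH ∧ nine spine
estimates (0/9 proved); BetaPertH ⇐ (D1) ∧ (D4) ∧ CAP+tail; G-an2-4 gates asym, D1 and NE2/3/4.
-/

set_option autoImplicit false

open scoped BigOperators Matrix Matrix.Norms.L2Operator
open NormedSpace Finset

namespace Summit.QuantumFields.BalabanUV.T4Continuum.NE7SameTopNormalLift

open Literature.MathematicalPhysics.QuantumFieldTheory.Balaban1983to89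
open B7Prop1Explicit B7Prop2Explicit
open T4AveragingDeficitWall (IsUnitaryCfg IsSkewDir SmallField vary curlAt dirL1)
open T4AveragingDeficitWallBoundary (IsPeriodicCfg periodBox)
open AveragingDeficitPeriodicCounting (IsPeriodicDir)
open AveragingDeficitMultiLevelPrep (cavgIter LevelSmall tower)
open MinimalActionLevels (perWin)
open BlockAverageVaryDisc (rho0)
open NE3HessForm (hess hessPlaq hessPlaqAt)
open NE3HessContinuity (bondL1At abs_hessPlaqAt_le)
open NE3HessBounds (norm_curlAt_le)
open NE3TangentCovariantTower (dirIter)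
open NE3LinearisedAverageSup (curvSum)
open NE3QbarIterCovLiftPrep (cruxC liftC_nonneg)
open NE3FramePotBoundW (tower_eq_pow_mul)
open NE3SmoothRightInverseW (rightInvW)
open NE3RightInverseSupLetters (supC)
open NE3RightInverseLetters (rightInvW_exact rightInvW_skew rightInvW_periodic rightInvW_R5)
open NE3QuadRemainderFibre (norm_dirIter_le_of_fibre)
open NE7TangentTransportGauge (dirIter_skew_periodic)
open NE7ExpansionSegmentLetters (sum_perWin_bondL1At_le)

noncomputable section

variable {d : ℕ} {n : Type*} [Fintype n] [DecidableEq n]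

/-- **(L1)′ FOR SAME-TOP FIELDS** (statement in the module docstring). [folklore] -/
theorem exists_normalLift_sameTop [Nonempty n] {L N : ℕ} [NeZero N] (hL : 2 ≤ L) (j : ℕ)
    {W : Site d → Fin d → (Matrix n n ℂ)ˣ} {x : ℝ} (hWu : IsUnitaryCfg W) (hWP : IsPeriodicCfg W ((N * L ^ (j + 1) : ℕ) : ℤ))
    (hx : 0 ≤ x) (hs : LevelSmall d L j x) (hs1 : LevelSmall d L (j + 1) x) (hWx : SmallField W x)
    (hθ : cruxC d L * (((L : ℝ) ^ (j + 1)) ^ 2 * x) < 1) (hε : ((L : ℝ) ^ (j + 1)) ^ 2 * x ≤ 1) (hA : curvSum d L (j + 1) x ≤ 2 / 3 * L)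
    {Z : Site d → Fin d → Matrix n n ℂ} (hZs : IsSkewDir Z) (hZP : IsPeriodicDir Z ((N * L ^ (j + 1) : ℕ) : ℤ))
    {α₀ : ℝ} (hα0 : 0 ≤ α₀) (hZα : ∀ y μ, ‖Z y μ‖ ≤ α₀) (hσ : 4 * (3 + 12 * (d : ℝ)) ^ 2 * (L : ℝ) ^ (j + 1) * α₀ ≤ rho0 d L ^ 2)
    (hTop : cavgIter L (j + 1) (vary W Z 1) = cavgIter L (j + 1) W) :
    ∃ AN : Site d → Fin d → Matrix n n ℂ, IsSkewDir AN ∧ IsPeriodicDir AN ((N * L ^ (j + 1) : ℕ) : ℤ) ∧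
      dirIter L (j + 1) W AN = dirIter L (j + 1) W Z ∧
      (∀ y μ, ‖AN y μ‖ ≤ supC d L / ((L : ℝ) ^ (j + 1) * (1 - cruxC d L * (((L : ℝ) ^ (j + 1)) ^ 2 * x)))
          * (4 * (3 + 12 * (d : ℝ)) ^ 3 / rho0 d L ^ 2 * ((L : ℝ) ^ (j + 1) * α₀) ^ 2)) ∧
      (∀ (z : Site d) (μ' ν' : Fin d), μ' ≠ ν' → ‖curlAt W AN z μ' ν'‖
          ≤ 4 * (supC d L / ((L : ℝ) ^ (j + 1) * (1 - cruxC d L * (((L : ℝ) ^ (j + 1)) ^ 2 * x)))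
              * (4 * (3 + 12 * (d : ℝ)) ^ 3 / rho0 d L ^ 2 * ((L : ℝ) ^ (j + 1) * α₀) ^ 2))) ∧
      (∀ Y : Site d → Fin d → Matrix n n ℂ, IsPeriodicDir Y ((N * L ^ (j + 1) : ℕ) : ℤ) →
        |hess W AN Y (perWin d (N * L ^ (j + 1)))|
          ≤ (24 * (Fintype.card (T4AveragingDeficitWall.Plane d) : ℝ)
              * (supC d L / ((L : ℝ) ^ (j + 1) * (1 - cruxC d L * (((L : ℝ) ^ (j + 1)) ^ 2 * x)))
                * (4 * (3 + 12 * (d : ℝ)) ^ 3 / rho0 d L ^ 2 * ((L : ℝ) ^ (j + 1) * α₀) ^ 2)))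
            * dirL1 Y (periodBox (d := d) (N * L ^ (j + 1)))) := by
  have hL1 : 1 ≤ L := by omega
  -- the period in the three spellings `N·L^{j+1} = L^{j+1}·N = tower L N (j+1)`
  have hT : tower L N (j + 1) = N * L ^ (j + 1) := by rw [tower_eq_pow_mul, Nat.mul_comm]
  have hWPt : IsPeriodicCfg W ((tower L N (j + 1) : ℕ) : ℤ) := by rw [hT]; exact hWP
  have hZPt : IsPeriodicDir Z ((tower L N (j + 1) : ℕ) : ℤ) := by rw [hT]; exact hZP
  have hWP' : IsPeriodicCfg W ((L ^ (j + 1) * N : ℕ) : ℤ) := by rw [Nat.mul_comm]; exact hWP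
  have hZP' : IsPeriodicDir Z ((L ^ (j + 1) * N : ℕ) : ℤ) := by rw [Nat.mul_comm]; exact hZP
  -- the datum `A = dirIter (j+1) W Z`: skew, `N`-periodic, and SECOND ORDER by the same-top premise
  obtain ⟨hAs, hAP⟩ := dirIter_skew_periodic (M := N) hL1 j hWu hWPt hx hs hWx hZs hZPt
  set q : ℝ := 4 * (3 + 12 * (d : ℝ)) ^ 3 / rho0 d L ^ 2 * ((L : ℝ) ^ (j + 1) * α₀) ^ 2 with hq
  have hq0 : 0 ≤ q := by positivity
  have hAq : ∀ (z : Site d) (κ : Fin d), ‖dirIter L (j + 1) W Z z κ‖ ≤ q := fun z κ =>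
    norm_dirIter_le_of_fibre hL hWu hWP' hx hs1 hWx hA hZs hZP' hα0 hZα hσ hTop z κ
  -- the lift `AN = R_W A`
  set m : ℝ := supC d L / ((L : ℝ) ^ (j + 1) * (1 - cruxC d L * (((L : ℝ) ^ (j + 1)) ^ 2 * x))) * q with hm
  have hmAN : ∀ y μ, ‖rightInvW hL j hWu hx hs hWx N hθ hAs y μ‖ ≤ m := fun y μ =>
    rightInvW_R5 hL j hWu hx hs hWx hθ hε hAs hq0 hAq y μ
  have h1θ : 0 < 1 - cruxC d L * (((L : ℝ) ^ (j + 1)) ^ 2 * x) := by linarith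
  have hsupC0 : 0 ≤ supC d L := by
    unfold supC NE3RightInverseSupLetters.corrC NE3RightInverseSupLetters.frameC; have := liftC_nonneg d; positivity
  have hm0 : 0 ≤ m := by rw [hm]; positivity
  -- the four-bond sum of the lift is `≤ 4m`
  have hbond : ∀ (z : Site d) (μ ν : Fin d), bondL1At (rightInvW hL j hWu hx hs hWx N hθ hAs) z μ ν ≤ 4 * m := by
    intro z μ ν
    unfold bondL1At
    linarith [hmAN z μ, hmAN (z + e μ) ν, hmAN (z + e ν) μ, hmAN z ν]
  refine ⟨rightInvW hL j hWu hx hs hWx N hθ hAs, rightInvW_skew hL j hWu hx hs hWx hθ hAs,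
    rightInvW_periodic hL j hWu hWPt hx hs hWx hθ hAs, rightInvW_exact hL j hWu hWPt hx hs hWx hθ hAs hAP, hmAN, fun z μ' ν' _ => ?_, fun Y hYP => ?_⟩
  · -- the curl: four dressed bonds
    refine (norm_curlAt_le hWu _ z μ' ν').trans ?_
    have h := hbond z μ' ν'
    unfold bondL1At at h
    exact h
  · -- the Hessian pairing: `|hess| ≤ Σ_p 3·bl₁(AN)(p)·bl₁(Y)(p) ≤ 12m·Σ_p bl₁(Y)(p) ≤ 12m·2·#Plane·‖Y‖₁`
    have hP1 : 1 ≤ N * L ^ (j + 1) := Nat.pos_of_ne_zero (mul_ne_zero (NeZero.ne N) (pow_ne_zero _ (by omega)))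
    have hsum := sum_perWin_bondL1At_le hP1 hYP
    have h1 : |hess W (rightInvW hL j hWu hx hs hWx N hθ hAs) Y (perWin d (N * L ^ (j + 1)))|
        ≤ ∑ p ∈ perWin d (N * L ^ (j + 1)), 12 * m * bondL1At Y p.1 p.2.1.1 p.2.1.2 := by
      unfold hess hessPlaq
      refine (Finset.abs_sum_le_sum_abs _ _).trans (Finset.sum_le_sum fun p _ => ?_)
      refine (abs_hessPlaqAt_le hWu _ Y p.1 p.2.1.1 p.2.1.2).trans ?_
      have hY0 : 0 ≤ bondL1At Y p.1 p.2.1.1 p.2.1.2 := by unfold bondL1At; positivity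
      have hb := hbond p.1 p.2.1.1 p.2.1.2
      nlinarith
    rw [← Finset.mul_sum] at h1
    refine h1.trans ?_
    have h12 : 0 ≤ 12 * m := by positivity
    calc 12 * m * ∑ p ∈ perWin d (N * L ^ (j + 1)), bondL1At Y p.1 p.2.1.1 p.2.1.2
        ≤ 12 * m * (2 * (Fintype.card (T4AveragingDeficitWall.Plane d) : ℝ) * dirL1 Y (periodBox (d := d) (N * L ^ (j + 1)))) :=
          mul_le_mul_of_nonneg_left hsum h12
      _ = _ := by rw [hm, hq]; ring

end

end Summit.QuantumFields.BalabanUV.T4Continuum.NE7SameTopNormalLift
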